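import Mathlib
import Literature.Analysis.FluidPDE.LocalBiotSavartCalculus

/-!
# Twist identity — crux stmt-NavierStokesRegularity-11741 (`IsobarTomography.IsobaricLinesLiouville`),
# line Ideator2Sketch (card flux-surface-persistence), stub stub_twistIdentity

The momentum equation of a classical Navier–Stokes solution (`ν = 1`, `f = 0`, tree convention
`∂ₜv + (v·∇)v = Δv − ∇q`) in Lamb form, dotted with the vorticity `ω = curl v`:

`⟪ω, ∂ₜv⟫ + ⟪ω, ∇(‖v‖²/2)⟫ + ⟪ω, curl curl v⟫ + ⟪ω, ∇q⟫ = 0` pointwise on `(-∞,0) × ℝ³`.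

Proof. Insert `∂ₜv = Δv − ∇q − (v·∇)v` (`IsClassicalNSSolutionOn.momentum`). Two facts close it:
* `curl curl v = −Δv` for the divergence-free `C²` slice `v t`
  (`Literature.Analysis.FluidPDE.curl_curl_eq_neg_laplacian`), so
  `⟪ω, Δv⟫ + ⟪ω, curl curl v⟫ = 0`;
* `⟪ω, (v·∇)v⟫ = ⟪ω, ∇(‖v‖²/2)⟫`: by the chain rule `⟪∇(‖v‖²/2)(x), h⟫ = ⟪v x, Dv(x) h⟫`
  (Mathlib `HasFDerivAt.norm_sq`), and `⟪curl v x, Dv(x) (v x)⟫ = ⟪v x, Dv(x) (curl v x)⟫` is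
  the linear-algebra identity `⟪curl A, A a⟫ = ⟪a, A (curl A)⟫` for the axial vector
  `curl A = curlCLM A` of a `3 × 3` matrix `A` (equivalently `⟪ω × v, ω⟫ = 0`), checked in
  coordinates.
Everything is Mathlib + the tree's `VorticityStretching` / `LocalBiotSavartCalculus` calculus.
`(EuclideanSpace ℝ (Fin 3))` is file-local notation for `EuclideanSpace ℝ (Fin 3)` (the registered stub signature is
stated with it).
-/

noncomputable section

open scoped InnerProductSpace RealInnerProductSpace ContDiff Laplacian
open Literature.Analysis.FluidPDE Set Function

-- the problem directory repeats the summit name (`NavierStokesRegularity/NavierStokesRegularity`,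
-- D-0017), which core's `dupNamespace` linter reports on every declaration of this namespace
set_option linter.dupNamespace false

namespace Summit.NavierStokesRegularity.NavierStokesRegularity.Theorems.IsobaricLinesLiouville.FluxSurfacePersistence


/-- The axial vector of a `3 × 3` matrix is "symmetric against it":
`⟪curl A, A a⟫ = ⟪a, A (curl A)⟫` for every linear `A : ℝ³ → ℝ³` and `a ∈ ℝ³`, where
`curl A = curlCLM A = (A₃₂ − A₂₃, A₁₃ − A₃₁, A₂₁ − A₁₂)`; equivalently
`⟪(A − Aᵀ) a, curl A⟫ = ⟪curl A × a, curl A⟫ = 0` (Majda–Bertozzi, §1.4, (1.19)–(1.21)).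
Pure coordinate algebra. -/
theorem inner_curlCLM_apply_eq_inner_apply_curlCLM (A : (EuclideanSpace ℝ (Fin 3)) →L[ℝ] (EuclideanSpace ℝ (Fin 3))) (a : (EuclideanSpace ℝ (Fin 3))) :
    ⟪curlCLM A, A a⟫ = ⟪a, A (curlCLM A)⟫ := by
  have ha : ∀ i, A a i = ∑ m, a m * A (EuclideanSpace.single m (1 : ℝ)) i :=
    fun i => clm_apply_coord A a i
  have hc : ∀ i, A (curlCLM A) i = ∑ m, (curlCLM A) m * A (EuclideanSpace.single m (1 : ℝ)) i :=
    fun i => clm_apply_coord A (curlCLM A) i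
  simp only [PiLp.inner_apply, RCLike.inner_apply, conj_trivial, Fin.sum_univ_three, ha, hc]
  simp only [curlCLM_apply, PiLp.toLp_apply, Matrix.cons_val_zero, Matrix.cons_val_one,
    Matrix.cons_val_two, Matrix.head_cons, Matrix.tail_cons]
  ring

/-- `⟪curl v x, Dv(x) (v x)⟫ = ⟪v x, Dv(x) (curl v x)⟫`: the vorticity pairs the convective term
`(v·∇)v` exactly as it pairs `∇(‖v‖²/2)` (i.e. `⟪ω, ω × v⟫ = 0` in the Lamb decomposition
`(v·∇)v = ω × v + ∇(‖v‖²/2)`). -/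
theorem inner_curl_convect_self (U : (EuclideanSpace ℝ (Fin 3)) → (EuclideanSpace ℝ (Fin 3))) (x : (EuclideanSpace ℝ (Fin 3))) :
    ⟪curl U x, fderiv ℝ U x (U x)⟫ = ⟪U x, fderiv ℝ U x (curl U x)⟫ := by
  rw [curl_eq_curlCLM]
  exact inner_curlCLM_apply_eq_inner_apply_curlCLM (fderiv ℝ U x) (U x)

/-- Chain rule for the kinetic-energy density: for `U` differentiable at `x`,
`⟪w, ∇(‖U‖²/2)(x)⟫ = ⟪U x, DU(x) w⟫` (Mathlib `HasFDerivAt.norm_sq` and the Riesz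
representation of the gradient). -/
theorem inner_gradient_half_norm_sq {U : (EuclideanSpace ℝ (Fin 3)) → (EuclideanSpace ℝ (Fin 3))} {x : (EuclideanSpace ℝ (Fin 3))} (hU : DifferentiableAt ℝ U x)
    (w : (EuclideanSpace ℝ (Fin 3))) : ⟪w, gradient (fun y => ‖U y‖ ^ 2 / 2) x⟫ = ⟪U x, fderiv ℝ U x w⟫ := by
  have h1 : HasFDerivAt (fun y => ‖U y‖ ^ 2) (2 • (innerSL ℝ (U x)).comp (fderiv ℝ U x)) x :=
    hU.hasFDerivAt.norm_sq
  have h2 : HasFDerivAt (fun y => ‖U y‖ ^ 2 / 2)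
      ((2 : ℝ)⁻¹ • (2 • (innerSL ℝ (U x)).comp (fderiv ℝ U x))) x := by
    have h := h1.const_smul (2 : ℝ)⁻¹
    refine h.congr_of_eventuallyEq (Filter.Eventually.of_forall fun y => ?_)
    simp only [Pi.smul_apply, smul_eq_mul]
    ring
  rw [real_inner_comm, gradient, InnerProductSpace.toDual_symm_apply, h2.fderiv]
  simp only [_root_.smul_apply, ContinuousLinearMap.comp_apply, innerSL_apply_apply, smul_eq_mul]
  ring

/-- **Twist identity** (momentum in Lamb form, `∂ₜv + ω × v + ∇(q + |v|²/2) = -curl curl v` for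
`div v = 0`, dotted with `ω`): for a classical solution (`ν = 1`, `f = 0`) on `(-∞,0)`,
`⟪ω, ∂ₜv⟫ + ⟪ω, ∇(|v|²/2)⟫ + ⟪ω, curl curl v⟫ + ⟪ω, ∇q⟫ = 0` pointwise. -/
theorem stub_twistIdentity :
    ∀ (v : ℝ → (EuclideanSpace ℝ (Fin 3)) → (EuclideanSpace ℝ (Fin 3))) (q : ℝ → (EuclideanSpace ℝ (Fin 3)) → ℝ), IsClassicalNSSolutionOn (Set.Iio 0) 1 0 v q →
      ∀ t < 0, ∀ x : (EuclideanSpace ℝ (Fin 3)),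
        ⟪curl (v t) x, timeDerivWithin (Set.Iio 0) v t x⟫_ℝ
          + ⟪curl (v t) x, gradient (fun y => ‖v t y‖ ^ 2 / 2) x⟫_ℝ
          + ⟪curl (v t) x, curl (curl (v t)) x⟫_ℝ
          + ⟪curl (v t) x, gradient (q t) x⟫_ℝ = 0 := by
  intro v q h t ht x
  have ht' : t ∈ Set.Iio (0 : ℝ) := ht
  have hv2 : ContDiff ℝ 2 (v t) := (h.contDiff_velocity ht').of_le (by norm_cast)
  have hvx : DifferentiableAt ℝ (v t) x := (hv2.differentiable (by norm_num)) x
  -- the momentum equation, solved for `∂ₜv`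
  have hm := h.momentum t ht' x
  have e : timeDerivWithin (Set.Iio 0) v t x =
      (Δ (v t)) x - gradient (q t) x - convect (v t) (v t) x := by
    rw [one_smul, Pi.zero_apply, Pi.zero_apply, add_zero] at hm
    rw [← hm]
    abel
  -- `curl curl v = -Δ v` on the divergence-free slice
  have hΔ : curl (curl (v t)) x = -(Δ (v t)) x :=
    curl_curl_eq_neg_laplacian hv2 (h.divFree t ht') x
  -- `⟪ω, (v·∇)v⟫ = ⟪ω, ∇(‖v‖²/2)⟫`
  have hL : ⟪curl (v t) x, convect (v t) (v t) x⟫ =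
      ⟪curl (v t) x, gradient (fun y => ‖v t y‖ ^ 2 / 2) x⟫ := by
    rw [convect_apply, inner_curl_convect_self, inner_gradient_half_norm_sq hvx]
  rw [e, hΔ, inner_sub_right, inner_sub_right, inner_neg_right, hL]
  ring

end Summit.NavierStokesRegularity.NavierStokesRegularity.Theorems.IsobaricLinesLiouville.FluxSurfacePersistence

end
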